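import Literature.NumberTheory.LFunctions.Zhang2022.DetectorDictShiftDischarge

/-!
# Zhang (2022) §18-margin repair rung, barrier extension (cell landau-siegel §E, rows S-E-p5-13 / S-E-p6-3):
# the NO-OVERLAP GLUED shift-detector family with the glued slot REMOVED from the verdict (Family B flipped)

Y. Zhang, *Discrete mean estimates and the Landau–Siegel zero*, arXiv:2211.02515v1 (2022) [Zhang2022LandauSiegel] —
an unrefereed manuscript under adjudication. **WHAT THIS IS NOT: a claim about its Theorems 1–2, about Landau–Siegel
zeros, about Parity, or about a repaired `Margin232`. The programme SEARCHES and TYPES; no claim about Landau–Siegel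
zeros, Theorems 1–2 of arXiv:2211.02515 or a repaired Margin232 until a kernel theorem says so.**

## What this leaf does (bookkeeping over landed calculus; no numerics, no new `Prop` facts)

Family B of `RepairDetGlued` (ls-barrier-p6 g3, p492465) is `Repair.familyDetGluedSep`: designs
`(b; t₁,t₂; g₁,g₂; f₁,f₂)` = a SIGN-ADMISSIBLE three-shift detector (`Det.SignAdmissible b`, in the Part-III box
`Det.InShiftBox b`) run against TWO-SIDED glued legs whose sides are one-sided kinked profiles supported in
`[0,t₁]`, `[0,t₂]` with no overlap after reflection (`t₁ + t₂ ≤ 1`, `Det.SidesAt`); its verdict DISPLAYS the glued slot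
`Det.GluedFormPSD b` («IF the detector's glued form is `≥ 0` on all glued sides THEN
`¬ (𝔅ᵍ_b(g₁,g₂)·𝔅ᵍ_b(f₁,f₂) < ‖P^dict_b(g₁+R̃g₂, f₁+R̃f₂)‖²)`»).

The slot is now a TREE THEOREM for every sign-admissible triple — `Det.gluedFormPSD_of_signAdmissible`
(`DetectorTwoSidedGlued`, ls-barrier-p5 g4 p495072; the two-sided doubling chain [K1] ls-barrier-p2 g3 · [K1″/K6″]
ls-barrier-p5 g4 · [K2″] ls-barrier-num g3 p492723 · [K3′] ls-Bmulti-typer-2 g3 p488397 · [K5] in tree; 0 facts).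
The member-by-member conclusion is `Repair.detGluedSep_not_closing` (`DetectorDictShiftDischarge`, ls-barrier-p6 g3
p495442, citing that slot theorem). This leaf records the slot-free FAMILY object for the class book, exactly as
`RepairDetShiftUnconditional` (ls-barrier-p6 g3) did for row 17 (`familyDetShiftUncond`) and `DetectorDictShiftDischarge`
for Family A (`familyDetGluedUncond`):

* `Repair.DetGluedSepDesign.VerdictFree` (the bare conclusion), `verdict_iff_slot_imp_free`, `InClass.gluedFormPSD`
  (the slot on the class), `normSq_le_detGluedSep_unconditional` (Cauchy–Schwarz itself),
  `not_sqrt_closing_detGluedSep_unconditional` (the §2 threshold shape);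
* the slot-free family **`Repair.familyDetGluedSepUncond`** (same designs, same class predicate —
  `familyDetGluedSepUncond_sameClass`), **`familyDetGluedSepUncond_decided`** (hypothesis-free, by
  `Repair.detGluedSep_not_closing`), `rplus_detGluedSepUncond_decided`, `rplus_detGluedSep_both_decided`.

Currency (C3(e)): `Det.FormDetGlued b` = the continued formula-I calculus of the candidate recipe on both sides plus the
cell's formula-II glue block (`Det.shiftGlueW`, `Det.shiftGlue0`; registry rows E-010 / «formula II at general b», the
(A)-world meaning not claimed here), exact for non-overlapping supports. Nothing here is a statement about zeros.
Standard axioms.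

References: Y. Zhang, arXiv:2211.02515v1 (2022), §2 (2.13), Lemma 2.3, (2.16)–(2.19), Props. 2.4–2.6, (2.32)–(2.33)
[pp. 5–6, 10–11]; §7 Prop. 7.1, (7.2) [p. 44]; §12 (12.6)–(12.8); §18 (18.1). [cite: Zhang2022LandauSiegel, §§2, 7, 12, 18]
-/

noncomputable section

open Real Complex ComplexConjugate

namespace Literature.NumberTheory.LFunctions.Zhang2022

namespace Repair

open Det

namespace DetGluedSepDesign

/-- **The slot-free verdict of a no-overlap glued shift-detector design**: the bare conclusion
`¬ (𝔅ᵍ_b(g₁,g₂)·𝔅ᵍ_b(f₁,f₂) < ‖P^dict_b(g₁+R̃g₂, f₁+R̃f₂)‖²)` — Family B's verdict with the glued slot removed.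
[cite: Zhang2022LandauSiegel, §2 (2.18), Props. 2.4–2.6, (2.32)–(2.33); §18 (18.1)] -/
def VerdictFree (d : DetGluedSepDesign) : Prop :=
  ¬ (FormDetGlued d.b d.g₁ d.g₁' d.g₂ d.g₂' * FormDetGlued d.b d.f₁ d.f₁' d.f₂ d.f₂' <
      ‖DictShiftPolar d.b (gluedProfile d.g₁ d.g₂) (gluedDeriv d.g₁' d.g₂')
          (gluedProfile d.f₁ d.f₂) (gluedDeriv d.f₁' d.f₂')‖ ^ 2)

/-- Family B's verdict IS «slot → slot-free verdict» (definitional bookkeeping).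
[cite: Zhang2022LandauSiegel, §2 (2.32)–(2.33)] -/
theorem verdict_iff_slot_imp_free (d : DetGluedSepDesign) :
    d.Verdict ↔ (GluedFormPSD d.b → d.VerdictFree) :=
  Iff.rfl

/-- The slot-free verdict implies Family B's displayed-slot verdict. [cite: Zhang2022LandauSiegel, §2 (2.32)–(2.33)] -/
theorem verdict_of_verdictFree (d : DetGluedSepDesign) (h : d.VerdictFree) : d.Verdict := fun _ => h

/-- **The slot of every member holds** (`Det.gluedFormPSD_of_signAdmissible` at the member's sign-admissible `b`).
[cite: Zhang2022LandauSiegel, §7 Prop. 7.1 p.44, (7.2); §12 (12.6)–(12.8)] -/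
theorem InClass.gluedFormPSD {d : DetGluedSepDesign} (h : d.InClass) : GluedFormPSD d.b :=
  gluedFormPSD_of_signAdmissible h.1

end DetGluedSepDesign

/-- the Cauchy–Schwarz inequality itself on the class, hypothesis-free:
`‖P^dict_b(g₁+R̃g₂, f₁+R̃f₂)‖² ≤ 𝔅ᵍ_b(g₁,g₂)·𝔅ᵍ_b(f₁,f₂)`. [cite: Zhang2022LandauSiegel, §2 after (2.33); §18 (18.1)] -/
theorem normSq_le_detGluedSep_unconditional (d : DetGluedSepDesign) (h : d.InClass) :
    ‖DictShiftPolar d.b (gluedProfile d.g₁ d.g₂) (gluedDeriv d.g₁' d.g₂')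
        (gluedProfile d.f₁ d.f₂) (gluedDeriv d.f₁' d.f₂')‖ ^ 2
      ≤ FormDetGlued d.b d.g₁ d.g₁' d.g₂ d.g₂' * FormDetGlued d.b d.f₁ d.f₁' d.f₂ d.f₂' :=
  norm_sq_dictShiftPolar_glued_le h.1.ne_zero h.gluedFormPSD h.2.2.1 h.2.2.2.1 h.2.2.2.2

/-- the threshold shape of the §2 final step on the class, hypothesis-free: bounds `𝔅ᵍ_b(g) ≤ q`, `𝔅ᵍ_b(f) ≤ c_J`,
`dd ≤ ‖P^dict_b‖` never give `√(q·c_J) < dd`. [cite: Zhang2022LandauSiegel, §2 (2.18), Props. 2.4–2.6 p.6, (2.32)–(2.33)] -/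
theorem not_sqrt_closing_detGluedSep_unconditional (d : DetGluedSepDesign) (h : d.InClass) {q cJ dd : ℝ}
    (hq : FormDetGlued d.b d.g₁ d.g₁' d.g₂ d.g₂' ≤ q) (hcJ : FormDetGlued d.b d.f₁ d.f₁' d.f₂ d.f₂' ≤ cJ)
    (hd : dd ≤ ‖DictShiftPolar d.b (gluedProfile d.g₁ d.g₂) (gluedDeriv d.g₁' d.g₂')
        (gluedProfile d.f₁ d.f₂) (gluedDeriv d.f₁' d.f₂')‖) :
    ¬ (Real.sqrt (q * cJ) < dd) := by
  intro hlt
  have hcs := normSq_le_detGluedSep_unconditional d h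
  have hslot := h.gluedFormPSD
  obtain ⟨-, -, ht, hg, hf⟩ := h
  have hdd : 0 ≤ dd := (Real.sqrt_nonneg _).trans hlt.le
  have hg0 : 0 ≤ FormDetGlued d.b d.g₁ d.g₁' d.g₂ d.g₂' := hslot _ _ _ _ (hg.gluedSides ht)
  have hf0 : 0 ≤ FormDetGlued d.b d.f₁ d.f₁' d.f₂ d.f₂' := hslot _ _ _ _ (hf.gluedSides ht)
  have h1 : dd ^ 2 ≤ q * cJ := by
    calc dd ^ 2 ≤ ‖DictShiftPolar d.b (gluedProfile d.g₁ d.g₂) (gluedDeriv d.g₁' d.g₂')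
            (gluedProfile d.f₁ d.f₂) (gluedDeriv d.f₁' d.f₂')‖ ^ 2 := by gcongr
      _ ≤ FormDetGlued d.b d.g₁ d.g₁' d.g₂ d.g₂' * FormDetGlued d.b d.f₁ d.f₁' d.f₂ d.f₂' := hcs
      _ ≤ q * cJ := mul_le_mul hq hcJ hf0 (hg0.trans hq)
  have h2 : dd ≤ Real.sqrt (q * cJ) := by
    rw [← Real.sqrt_sq hdd]
    exact Real.sqrt_le_sqrt h1
  exact absurd hlt (not_lt.2 h2)

/-! ### The slot-free family (extension protocol of `RepairRplus`) -/

/-- **family «sign-admissible shift detector, no-overlap glued legs, FormDetGlued currency — SLOT-FREE verdict»**: the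
designs and the class predicate of Family B (`familyDetGluedSep`) verbatim; the verdict is the bare conclusion
(nothing displayed, nothing conditional in the class). [cite: Zhang2022LandauSiegel, §2 Lemma 2.3, (2.32)–(2.33); §12 (12.6)–(12.8)] -/
def familyDetGluedSepUncond : DesignFamily where
  Design := DetGluedSepDesign
  InClass := DetGluedSepDesign.InClass
  Verdict := DetGluedSepDesign.VerdictFree

/-- **Same designs, same class as Family B** — only the verdict changed (slot removed).
[cite: Zhang2022LandauSiegel, §2 Lemma 2.3, (2.32)–(2.33)] -/
theorem familyDetGluedSepUncond_sameClass :
    familyDetGluedSepUncond.Design = familyDetGluedSep.Design ∧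
      ∀ d : DetGluedSepDesign, familyDetGluedSepUncond.InClass d ↔ familyDetGluedSep.InClass d :=
  ⟨rfl, fun _ => Iff.rfl⟩

/-- The slot-free verdict unfolded. [cite: Zhang2022LandauSiegel, §2 (2.18), (2.32)–(2.33)] -/
theorem familyDetGluedSepUncond_verdict_iff (d : DetGluedSepDesign) :
    familyDetGluedSepUncond.Verdict d ↔
      ¬ (FormDetGlued d.b d.g₁ d.g₁' d.g₂ d.g₂' * FormDetGlued d.b d.f₁ d.f₁' d.f₂ d.f₂' <
          ‖DictShiftPolar d.b (gluedProfile d.g₁ d.g₂) (gluedDeriv d.g₁' d.g₂')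
              (gluedProfile d.f₁ d.f₂) (gluedDeriv d.f₁' d.f₂')‖ ^ 2) :=
  Iff.rfl

/-- The slot-free family's verdict implies Family B's verdict, member by member.
[cite: Zhang2022LandauSiegel, §2 (2.32)–(2.33)] -/
theorem familyDetGluedSep_verdict_of_uncond (d : DetGluedSepDesign) (h : familyDetGluedSepUncond.Verdict d) :
    familyDetGluedSep.Verdict d :=
  fun _ => h

/-- Conversely Family B's verdict together with its slot gives the slot-free verdict.
[cite: Zhang2022LandauSiegel, §2 (2.32)–(2.33)] -/
theorem familyDetGluedSepUncond_verdict_of_slot (d : DetGluedSepDesign) (hV : familyDetGluedSep.Verdict d)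
    (hs : GluedFormPSD d.b) : familyDetGluedSepUncond.Verdict d :=
  hV hs

/-- **`familyDetGluedSepUncond` is decided — hypothesis-free.** [cite: Zhang2022LandauSiegel, §2 (2.32)–(2.33)] -/
theorem familyDetGluedSepUncond_decided : familyDetGluedSepUncond.Decided :=
  fun d h => detGluedSep_not_closing d h

/-- **`R⁺ ++ [familyDetGluedSepUncond]` is decided** (`RepairRplus.rplus_extend`).
[cite: Zhang2022LandauSiegel, §2 (2.32)–(2.33)] -/
theorem rplus_detGluedSepUncond_decided : ClassDecided (Rplus ++ [familyDetGluedSepUncond]) :=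
  rplus_extend familyDetGluedSepUncond_decided

/-- Both readings of Family B at once: `R⁺ ++ [familyDetGluedSep, familyDetGluedSepUncond]` is decided.
[cite: Zhang2022LandauSiegel, §2 (2.32)–(2.33)] -/
theorem rplus_detGluedSep_both_decided :
    ClassDecided (Rplus ++ [familyDetGluedSep, familyDetGluedSepUncond]) :=
  classDecided_append.2 ⟨rplus_decided,
    classDecided_cons familyDetGluedSep_decided (classDecided_cons familyDetGluedSepUncond_decided classDecided_nil)⟩

end Repair

end Literature.NumberTheory.LFunctions.Zhang2022
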